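import Literature.NumberTheory.EllipticCurves.ShintaniSplitPeriods
import Literature.NumberTheory.EllipticCurves.ShintaniLiftCoeffCanonical
import HarnessLib

/-!
# Split orbits of the twisted Shintani lift: explicit coefficients by modular symbols

[[cite: Shintani1975, §2, Prop. 2.4, Lemma 2.7 (ii) and §3 (Lemma 3.1: Manin's symbols)]] —
combining `ShintaniSplitOrbits` (the orbit integral of a split vector for ANY conjugating
matrix, `orbitIntegral_split_of_conj`), the explicit conjugating matrix with `λ = +√Δ` whose
columns point to the root cusps (`exists_conj_explicit`), the canonicity of the coefficient
(`ShintaniLiftCoeffCanonical.orbCoef_eq_of_data`) and the period evaluation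
(`ShintaniSplitPeriods.period_eq_cuspValue_sub`), we PROVE **`orbCoef_split_explicit`**: for an
orbit `ω` with `Δ(k_ω) = m₀² > 0` and `x₀ = 64 k₀ ≠ 0`,
`coef_D(ω) = 8√D · c_D(k_ω) · ({∞, q₁}_φ - {∞, q₂}_φ)/(2πi)` with the root cusps
`q₁ = (-x₁ - m₀)/(2x₀)`, `q₂ = (-x₁ + m₀)/(2x₀)` and `{∞, q} = modularSymbol φ q`.
(Auxiliary: `ratio_of_fac`, `cuspValue_eq_modularSymbol`.)

No named facts, no new definitions.
-/

noncomputable section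

open scoped MatrixGroups ModularForm Modular Topology ENNReal Pointwise Manifold
open UpperHalfPlane hiding I
open Complex Filter MeasureTheory Set CongruenceSubgroup ModularGroup Real MulAction Asymptotics
open Literature.NumberTheory.EllipticCurves.ModularForms

namespace Literature.NumberTheory.EllipticCurves.Shintani

/-! ### The split orbit integral for ANY conjugating matrix -/

/-- `orbitIntegral_split` for an arbitrary `M` with `ι♮(k_ω) ∘ M = λXY`. [cite: Shintani1975, §2, Prop. 2.4] -/
theorem orbitIntegral_split_of_conj (f : CuspForm (Gamma0 64) 2)
    (ω : orbitRel.Quotient (Gamma0Plus 64) (Fin 3 → ℤ)) {m₀ : ℤ} (hm₀ : 0 < m₀)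
    (hΔ : intDisc ω.out = m₀ ^ 2) {M : SL(2, ℝ)} {lam : ℝ} (hlam : lam ≠ 0)
    (hM : actSL M (latSharp ω.out) = xyForm lam) (D : ℕ) [NeZero D] (hD : Odd D) (z : ℍ) :
    orbitIntegral D f z ω = anisoConst D z ω.out lam *
        (∫ r in Ioi (0 : ℝ), slashSL f M (polarPt r (π / 2)) * unitAt (π / 2)) *
          (Real.sqrt (π / (4 * π * (zScaled D z : ℂ).im * lam ^ 2)) : ℝ) := by
  set k₀ := ω.out with hk₀
  obtain ⟨⟨A, Nu, hN, hMfac⟩, ⟨A', Nu', hN', hPfac⟩⟩ := exists_factorizations_of_sq hm₀ hΔ hM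
  -- trivial stabiliser: `orbitDomain` and `univ` are both fundamental domains
  have hbot := stabK_eq_bot_of_sq hm₀ hΔ (k₀ := k₀)
  haveI : Subsingleton (stabK k₀) := by rw [hbot]; infer_instance
  have hFD := isFundamentalDomain_orbitDomain k₀
  have hFD' : IsFundamentalDomain (stabK k₀) (Set.univ : Set ℍ) (volume : Measure ℍ) :=
    isFundamentalDomain_univ_of_subsingleton
  have hinv : ∀ (γ : stabK k₀) (w : ℍ), liftTerm D f z k₀ (γ • w) = liftTerm D f z k₀ w :=
    liftTerm_stab_invariant D hD f z k₀
  -- integrability on `ℍ`, transported and moved to the plane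
  have hintH : IntegrableOn (liftTerm D f z k₀) Set.univ (volume : Measure ℍ) :=
    (hFD.integrableOn_iff hFD' hinv).mp (tsum_quotient_integral_liftTerm_eq hD f z k₀).1
  have hintM : IntegrableOn (fun u ↦ liftTerm D f z k₀ (M • u)) Set.univ (volume : Measure ℍ) := by
    rw [← integrableOn_sl_smul_set_real_iff M, Set.smul_set_univ]; exact hintH
  set ψ : ℂ → ℂ := fun τ ↦ slashSL f M τ * anisoConst D z k₀ lam with hψdef
  set cc : ℝ := 4 * π * (zScaled D z : ℂ).im * lam ^ 2 with hcc
  have hcpos : 0 < cc := by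
    have h1 : 0 < (zScaled D z : ℂ).im := by rw [UpperHalfPlane.coe_im]; exact (zScaled D z).im_pos
    positivity
  have hplane_eq : ∀ w : ℂ, 0 < w.im →
      ((1 / w.im ^ 2 : ℝ) : ℂ) * liftTerm D f z k₀ (M • UpperHalfPlane.ofComplex w) = planeIntegrand ψ cc w := by
    intro w hw
    rw [liftTerm_sl_smul f z hM, planeIntegrand, UpperHalfPlane.ofComplex_apply_of_im_pos hw]
  have hplane : IntegrableOn (planeIntegrand ψ cc) {w : ℂ | 0 < w.im} := by
    have h := (FdCoord.integrableOn_image_iff (fun u ↦ liftTerm D f z k₀ (M • u)) MeasurableSet.univ).mpr hintM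
    rw [image_univ, UpperHalfPlane.range_coe] at h
    exact h.congr_fun (fun w hw ↦ hplane_eq w hw) (measurableSet_lt measurable_const Complex.measurable_im)
  -- the sibling's evaluation
  obtain ⟨C₀, -, hC₀⟩ := exists_norm_mul_im_le f
  have hCψ : ∀ w : ℂ, 0 < w.im → ‖ψ w‖ * w.im ≤ C₀ * ‖anisoConst D z k₀ lam‖ := by
    intro w hw
    calc ‖slashSL f M w * anisoConst D z k₀ lam‖ * w.im
        = (‖slashSL f M w‖ * w.im) * ‖anisoConst D z k₀ lam‖ := by rw [norm_mul]; ring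
      _ ≤ C₀ * ‖anisoConst D z k₀ lam‖ :=
        mul_le_mul_of_nonneg_right (norm_slashSL_mul_im_le f M hC₀ hw) (norm_nonneg _)
  have hψhol : DifferentiableOn ℂ ψ {w : ℂ | 0 < w.im} := (differentiableOn_slashSL f M).mul_const _
  have key := integral_sectorSet_Ioi_eq_mul_sqrt (ψ := ψ) (c := cc) hψhol hCψ
    (fun y hy ↦ tendsto_slashSL_mul_nhdsGT_zero f hN' hPfac _ hy)
    (fun y hy ↦ tendsto_slashSL_mul_atTop f hN hMfac _ hy)
    (fun θ hθ ↦ integrableOn_ray f hN hMfac hN' hPfac _ hθ)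
    (integrableOn_polarIntegrand_of_plane hψhol.continuousOn hplane)
  -- assemble
  unfold orbitIntegral
  rw [← hk₀, hFD.setIntegral_eq hFD' hinv, ← Set.smul_set_univ (a := M), setIntegral_sl_smul_set_real,
    FdCoord.setIntegral_eq_setIntegral_image _ MeasurableSet.univ, image_univ, UpperHalfPlane.range_coe]
  rw [show (UpperHalfPlane.upperHalfPlaneSet : Set ℂ) = {w : ℂ | 0 < w.im} from rfl,
    setIntegral_congr_fun (measurableSet_lt measurable_const Complex.measurable_im) (fun w hw ↦ hplane_eq w hw),
    setOf_im_pos_eq_sectorSet, key]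
  -- pull the constant out of the ray integral
  have hray : ∫ r in Ioi (0 : ℝ), ψ (polarPt r (π / 2)) * unitAt (π / 2) =
      anisoConst D z k₀ lam * ∫ r in Ioi (0 : ℝ), slashSL f M (polarPt r (π / 2)) * unitAt (π / 2) := by
    rw [← integral_const_mul]
    refine integral_congr_ae (Eventually.of_forall fun r ↦ ?_)
    simp only [hψdef]; ring
  rw [hray]


/-! ### The explicit conjugating matrix with `λ = +√Δ` and columns at the roots -/

/-- For `x₀ ≠ 0`, `disc x > 0`: `g = (-ξ₁, ξ₂/δ; -1, 1/δ)` (`ξ₁ = (-x₁-√Δ)/(2x₀)`,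
`ξ₂ = (-x₁+√Δ)/(2x₀)`, `δ = ξ₂ - ξ₁`) has `x ∘ g = √Δ · XY`, `g∞ = ξ₁`, `g0 = ξ₂`. [folklore] -/
theorem exists_conj_explicit {x : V} (hx0 : x 0 ≠ 0) (hdisc : 0 < disc x) :
    ∃ (a b c d : ℝ) (hdet : a * d - b * c = 1),
      actSL (slOf a b c d hdet) x = xyForm (Real.sqrt (disc x)) ∧ c = -1 ∧ d ≠ 0 ∧
      a / c = (-x 1 - Real.sqrt (disc x)) / (2 * x 0) ∧ b / d = (-x 1 + Real.sqrt (disc x)) / (2 * x 0) := by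
  set s : ℝ := Real.sqrt (disc x) with hs
  have hs2 : s ^ 2 = disc x := Real.sq_sqrt hdisc.le
  have hspos : 0 < s := Real.sqrt_pos.mpr hdisc
  set ξ₁ : ℝ := (-x 1 - s) / (2 * x 0) with hξ₁
  set ξ₂ : ℝ := (-x 1 + s) / (2 * x 0) with hξ₂
  have hd : disc x = x 1 ^ 2 - 4 * x 0 * x 2 := rfl
  have hdiff : ξ₂ - ξ₁ = s / x 0 := by rw [hξ₁, hξ₂]; field_simp; ring
  have hdne : ξ₂ - ξ₁ ≠ 0 := by rw [hdiff]; exact div_ne_zero hspos.ne' hx0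
  set δ : ℝ := ξ₂ - ξ₁ with hδ
  have hdet : (-ξ₁) * (1 / δ) - ξ₂ / δ * (-1) = 1 := by field_simp; ring
  refine ⟨-ξ₁, ξ₂ / δ, -1, 1 / δ, hdet, ?_, rfl, one_div_ne_zero hdne, by ring, by field_simp⟩
  rw [actSL_slOf]
  -- the root relations
  have hroot1 : x 0 * ξ₁ ^ 2 + x 1 * ξ₁ + x 2 = 0 := by rw [hξ₁]; field_simp; linear_combination hs2 + hd
  have hroot2 : x 0 * ξ₂ ^ 2 + x 1 * ξ₂ + x 2 = 0 := by rw [hξ₂]; field_simp; linear_combination hs2 + hd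
  have hsum : ξ₁ + ξ₂ = -x 1 / x 0 := by rw [hξ₁, hξ₂]; field_simp; ring
  have hprod : ξ₁ * ξ₂ = x 2 / x 0 := by
    rw [hξ₁, hξ₂]; field_simp; linear_combination -hs2 - hd
  -- the middle coordinate: `-2x₀ξ₁ξ₂ - x₁(ξ₁+ξ₂) - 2x₂ = s²/x₀ = s δ`
  have hmid : -(2 * x 0 * ξ₁ * (ξ₂ / δ)) + x 1 * (-(ξ₁ * δ⁻¹) + -(ξ₂ / δ)) + -(2 * x 2 * δ⁻¹) = s := by
    have e : -(2 * x 0 * ξ₁ * (ξ₂ / δ)) + x 1 * (-(ξ₁ * δ⁻¹) + -(ξ₂ / δ)) + -(2 * x 2 * δ⁻¹) =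
        (-(2 * x 0 * (ξ₁ * ξ₂)) - x 1 * (ξ₁ + ξ₂) - 2 * x 2) / δ := by
      field_simp; ring
    rw [e, hprod, hsum, div_eq_iff hdne, hdiff]
    field_simp
    linear_combination -hs2 - hd
  ext i
  fin_cases i
  · simp [xyForm]
    nlinarith [hroot1]
  · simp [xyForm]
    exact hmid
  · simp [xyForm]
    have : x 0 * (ξ₂ / δ) ^ 2 + x 1 * (ξ₂ / δ) * δ⁻¹ + x 2 * (δ ^ 2)⁻¹ = (x 0 * ξ₂ ^ 2 + x 1 * ξ₂ + x 2) / δ ^ 2 := by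
      field_simp
    rw [this, hroot2, zero_div]

/-! ### Identifying the cusps `A∞ = M∞`, `A'∞ = M0` -/

/-- From `M = A N` (`N` upper triangular) and `M₁₀ ≠ 0`: `A₁₀ ≠ 0` and `A₀₀/A₁₀ = M₀₀/M₁₀`. [folklore] -/
theorem ratio_of_fac {M : SL(2, ℝ)} {A : SL(2, ℤ)} {Nu : SL(2, ℝ)} (hN : (Nu 1 0 : ℝ) = 0)
    (hMfac : M = ((A : SL(2, ℤ)) : SL(2, ℝ)) * Nu) (hM10 : (M 1 0 : ℝ) ≠ 0) :
    (A 1 0 : ℤ) ≠ 0 ∧ ((A 0 0 : ℤ) : ℝ) / ((A 1 0 : ℤ) : ℝ) = (M 0 0 : ℝ) / (M 1 0 : ℝ) := by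
  have e : ∀ i, (M i 0 : ℝ) = ((A i 0 : ℤ) : ℝ) * Nu 0 0 := by
    intro i
    rw [hMfac]
    have : ((((A : SL(2, ℤ)) : SL(2, ℝ)) * Nu : SL(2, ℝ)) i 0 : ℝ) =
        (((A : SL(2, ℤ)) : SL(2, ℝ)) i 0 : ℝ) * Nu 0 0 + (((A : SL(2, ℤ)) : SL(2, ℝ)) i 1 : ℝ) * Nu 1 0 := by
      simp [Matrix.mul_apply, Fin.sum_univ_two]
    rw [this, hN, mul_zero, add_zero]
    simp [Matrix.SpecialLinearGroup.map_apply_coe]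
  have h10 := e 1
  have hA10 : ((A 1 0 : ℤ) : ℝ) ≠ 0 := by
    intro h; rw [h, zero_mul] at h10; exact hM10 h10
  have hNu : (Nu 0 0 : ℝ) ≠ 0 := by
    intro h; rw [h, mul_zero] at h10; exact hM10 h10
  refine ⟨by exact_mod_cast hA10, ?_⟩
  rw [e 0, h10]
  field_simp

/-- The cusp value at a factorization: `cuspValue φ A = {∞, q}` when `(q : ℝ) = M₀₀/M₁₀`. [folklore] -/
theorem cuspValue_eq_modularSymbol (f : CuspForm (Gamma0 64) 2) {M : SL(2, ℝ)} {A : SL(2, ℤ)} {Nu : SL(2, ℝ)}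
    (hN : (Nu 1 0 : ℝ) = 0) (hMfac : M = ((A : SL(2, ℤ)) : SL(2, ℝ)) * Nu) (hM10 : (M 1 0 : ℝ) ≠ 0)
    {q : ℚ} (hq : (q : ℝ) = (M 0 0 : ℝ) / (M 1 0 : ℝ)) :
    cuspValue f A = modularSymbol f q := by
  obtain ⟨hA10, hratio⟩ := ratio_of_fac hN hMfac hM10
  rw [cuspValue, if_neg hA10]
  congr 1
  have : ((((A 0 0 : ℤ) : ℚ) / ((A 1 0 : ℤ) : ℚ) : ℚ) : ℝ) = (q : ℝ) := by
    push_cast; rw [hratio, hq]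
  exact_mod_cast this

/-! ### The explicit coefficient of a split orbit -/

variable (D : ℕ) [NeZero D]

/-- **The coefficient of a split orbit by modular symbols**: for `ω` with `Δ(k_ω) = m₀² > 0` and
`x₀ = 64k₀ ≠ 0`, with the root cusps `q₁ = (-x₁ - m₀)/(2x₀)`, `q₂ = (-x₁ + m₀)/(2x₀)`,
`coef_D(ω) = 8√D · c_D(k_ω) · ({∞, q₁}_φ - {∞, q₂}_φ)/(2πi)`.
[cite: Shintani1975, §2, Lemma 2.7 (ii) and §3] -/
theorem orbCoef_split_explicit (hD : Odd D) (f : CuspForm (Gamma0 64) 2)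
    (ω : orbitRel.Quotient (Gamma0Plus 64) (Fin 3 → ℤ)) {m₀ : ℤ} (hm₀ : 0 < m₀)
    (hΔ : intDisc ω.out = m₀ ^ 2) (hx0 : latSharp ω.out 0 ≠ 0) {q₁ q₂ : ℚ}
    (hq₁ : (q₁ : ℝ) = (-latSharp ω.out 1 - m₀) / (2 * latSharp ω.out 0))
    (hq₂ : (q₂ : ℝ) = (-latSharp ω.out 1 + m₀) / (2 * latSharp ω.out 0)) :
    orbCoef D f ω = ((8 * Real.sqrt D : ℝ) : ℂ) * cD D ω.out *
      ((modularSymbol f q₁ - modularSymbol f q₂) / (2 * Real.pi * I)) := by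
  set x := latSharp ω.out with hx
  have hdiscR : disc x = ((m₀ : ℝ)) ^ 2 := by
    rw [hx, disc_latSharp_eq_intDisc, hΔ]; push_cast; ring
  have hposR : 0 < disc x := by rw [hdiscR]; exact pow_pos (by exact_mod_cast hm₀) 2
  have hpos : 0 < intDisc ω.out := by rw [hΔ]; positivity
  have hsqrt : Real.sqrt (disc x) = m₀ := by rw [hdiscR, Real.sqrt_sq (by exact_mod_cast hm₀.le)]
  obtain ⟨a, b, c, d, hdet, hM, hc, hd0, hcol1, hcol2⟩ := exists_conj_explicit hx0 hposR
  rw [hsqrt] at hM hcol1 hcol2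
  set M : SL(2, ℝ) := slOf a b c d hdet with hMdef
  have hm₀R : (m₀ : ℝ) ≠ 0 := by exact_mod_cast hm₀.ne'
  obtain ⟨⟨A, Nu, hN, hMfac⟩, ⟨A', Nu', hN', hPfac⟩⟩ := exists_factorizations_of_sq hm₀ hΔ hM
  -- the orbit data `(m₀, P)` with `P` the cusp-to-cusp period
  have hJ : ∀ z : ℍ, orbitIntegral D f z ω = anisoConst D z ω.out m₀ *
      (∫ r in Ioi (0 : ℝ), slashSL f M (polarPt r (π / 2)) * unitAt (π / 2)) *
        (Real.sqrt (π / (4 * π * (zScaled D z : ℂ).im * (m₀ : ℝ) ^ 2)) : ℝ) :=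
    fun z ↦ orbitIntegral_split_of_conj f ω hm₀ hΔ hm₀R hM D hD z
  have hl2 : (m₀ : ℝ) ^ 2 = intDisc ω.out := by rw [hΔ]; push_cast; ring
  rw [orbCoef_eq_of_data D hD f ω hpos hl2 hJ, period_eq_cuspValue_sub f hN hMfac hN' hPfac]
  -- the cusps
  have hM10 : (M 1 0 : ℝ) ≠ 0 := by simp [hMdef, slOf, hc]
  have hM00 : (M 0 0 : ℝ) / (M 1 0 : ℝ) = a / c := by simp [hMdef, slOf]
  obtain ⟨hP00, hP10⟩ := mul_S_inv_col M
  have hP10ne : ((M * (((ModularGroup.S : SL(2, ℤ)) : SL(2, ℝ)))⁻¹ : SL(2, ℝ)) 1 0 : ℝ) ≠ 0 := by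
    rw [hP10]; simp [hMdef, slOf, hd0]
  have hPratio : ((M * (((ModularGroup.S : SL(2, ℤ)) : SL(2, ℝ)))⁻¹ : SL(2, ℝ)) 0 0 : ℝ) /
      ((M * (((ModularGroup.S : SL(2, ℤ)) : SL(2, ℝ)))⁻¹ : SL(2, ℝ)) 1 0 : ℝ) = b / d := by
    rw [hP00, hP10, neg_div_neg_eq]; simp [hMdef, slOf]
  rw [cuspValue_eq_modularSymbol f hN hMfac hM10 (q := q₁) (by rw [hq₁, hM00, hcol1]),
    cuspValue_eq_modularSymbol f hN' hPfac hP10ne (q := q₂) (by rw [hq₂, hPratio, hcol2])]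
  -- `√Δ = m₀`
  have hsq : Real.sqrt (intDisc ω.out : ℝ) = m₀ := by
    rw [← hl2, Real.sqrt_sq (by exact_mod_cast hm₀.le)]
  rw [hsq]
  have hm₀C : ((m₀ : ℝ) : ℂ) ≠ 0 := Complex.ofReal_ne_zero.mpr hm₀R
  field_simp

end Literature.NumberTheory.EllipticCurves.Shintani
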